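import Mathlib.Analysis.Complex.CauchyIntegral
import Mathlib.Analysis.Calculus.InverseFunctionTheorem.Deriv
import Mathlib.Analysis.Calculus.ContDiff.RCLike
import Mathlib.Topology.Covering.Basic
import HarnessLib

/-!
# Uniformization of plane domains, brick N1c (criterion half): local holomorphic sections ⇒ covering

PROOF-ONLY file (no definitions; abc-iut cell, seat abc-iut-w5-d089 gen 8, brick «UNIF-G1P · N1c-CRITERION»
of abc-iut-L4-t8's programme behind the named fact `Complex.PlaneDomainDiscCovering`, GAP row G-L4t8g7-1).
Y. Fisher, J. H. Hubbard, B. S. Wittner, *A proof of the uniformization theorem for arbitrary plane domains*,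
Proc. Amer. Math. Soc. **104** (1988) 413–418, §3: the holomorphic map `F : 𝔻 → U` produced by the
square-root tower is shown to be a covering map by exhibiting, over every disc `B ⊆ U` and through every
point of `F⁻¹(B)`, a holomorphic local inverse ("sheet") of `F`.  THIS FILE isolates the covering-space
content of that step as a criterion, in the shape consumed by the programme's assembly:

* `Complex.deriv_ne_zero_of_holomorphicSection` — if a holomorphic `σ` on a disc `B` with `F ∘ σ = id_B`
  passes through `z` (`σ (F z) = z`), then `F′(z) ≠ 0`;
* (private) `exists_isOpen_injOn_of_deriv_ne_zero` — a holomorphic `F` is injective near a point where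
  `F′ ≠ 0` (Mathlib's inverse function theorem `HasStrictDerivAt.eventually_left_inverse`);
* `Complex.eqOn_of_holomorphicSections` — two continuous sections of `F` over a disc through the same
  point coincide (connectedness of the disc + local injectivity of `F`);
* **`Complex.surjOn_and_isCoveringMap_of_holomorphicSections`** — for `U ⊆ ℂ` open and preconnected
  and `F` holomorphic on the unit disc with `F(𝔻) ⊆ U`: if over EVERY disc `B ⊆ U` and through EVERY
  `z ∈ 𝔻` with `F z ∈ B` there is a holomorphic section `σ : B → 𝔻` of `F` with `σ (F z) = z`, then `F`
  maps `𝔻` ONTO `U` and its restriction `𝔻 → U` is a covering map (Mathlib `IsCoveringMap`: the disc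
  `B = ball x r ⊆ U` is an evenly covered neighbourhood of `x`, the sheets being the images of the
  sections, indexed by the fibre `F⁻¹(x)`, which is discrete by local injectivity).

Classical mathematics (covering-space bookkeeping; Forster, *Lectures on Riemann Surfaces*, §4);
nothing here touches [IUTchIII] Cor. 3.12.
[cite: FisherHubbardWittner1988, §3 p.416] [cite: Conway1978, Ch. IX §3]
-/

noncomputable section

open Set Metric Filter Topology Function

namespace Complex

variable {U : Set ℂ} {F : ℂ → ℂ}

/-- **A point through which a holomorphic section passes is not critical.** If `F` is holomorphic
on the unit disc, `σ` is holomorphic on the disc `ball c r`, `F (σ w) = w` on `ball c r`, `σ` maps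
`ball c r` into the unit disc and `σ (F z) = z` with `F z ∈ ball c r`, then `F′(z) ≠ 0`.
[cite: FisherHubbardWittner1988, §3 p.416] -/
theorem deriv_ne_zero_of_holomorphicSection (hF : DifferentiableOn ℂ F (ball 0 1))
    {c : ℂ} {r : ℝ} {σ : ℂ → ℂ} (hσ : DifferentiableOn ℂ σ (ball c r))
    (hσD : MapsTo σ (ball c r) (ball 0 1)) (hinv : ∀ w ∈ ball c r, F (σ w) = w)
    {z : ℂ} (hFz : F z ∈ ball c r) (hσz : σ (F z) = z) :
    deriv F z ≠ 0 := by
  -- `F ∘ σ = id` near `F z`, so `F′(z) · σ′(F z) = 1`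
  have hB : ball c r ∈ 𝓝 (F z) := isOpen_ball.mem_nhds hFz
  have hσ' : HasDerivAt σ (deriv σ (F z)) (F z) :=
    (hσ.differentiableAt hB).hasDerivAt
  have hzD : z ∈ ball (0 : ℂ) 1 := by simpa [hσz] using hσD hFz
  have hF' : HasDerivAt F (deriv F z) z :=
    (hF.differentiableAt (isOpen_ball.mem_nhds hzD)).hasDerivAt
  have hF'' : HasDerivAt F (deriv F (σ (F z))) (σ (F z)) := by rw [hσz]; exact hF'
  have hcomp : HasDerivAt (F ∘ σ) (deriv F (σ (F z)) * deriv σ (F z)) (F z) :=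
    hF''.comp (F z) hσ'
  have hid : HasDerivAt (F ∘ σ) 1 (F z) := by
    refine (hasDerivAt_id (F z)).congr_of_eventuallyEq ?_
    filter_upwards [hB] with w hw
    exact hinv w hw
  have h1 : deriv F (σ (F z)) * deriv σ (F z) = 1 := hcomp.unique hid
  rw [hσz] at h1
  intro h0
  rw [h0, zero_mul] at h1
  exact zero_ne_one h1

/-- **Local injectivity at a non-critical point.** A function holomorphic on the unit disc is
injective on some open neighbourhood (inside the disc) of any point where its derivative is
non-zero (inverse function theorem; private helper). [folklore] -/
private theorem exists_isOpen_injOn_of_deriv_ne_zero (hF : DifferentiableOn ℂ F (ball 0 1))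
    {z : ℂ} (hz : z ∈ ball (0 : ℂ) 1) (hFz : deriv F z ≠ 0) :
    ∃ N : Set ℂ, IsOpen N ∧ z ∈ N ∧ N ⊆ ball 0 1 ∧ InjOn F N := by
  have hD : ball (0 : ℂ) 1 ∈ 𝓝 z := isOpen_ball.mem_nhds hz
  have han : AnalyticAt ℂ F z := hF.analyticAt hD
  have hstrict : HasStrictDerivAt F (deriv F z) z :=
    (han.contDiffAt (n := 1)).hasStrictDerivAt one_ne_zero
  have hleft := hstrict.eventually_left_inverse hFz
  obtain ⟨N, hNsub, hNopen, hzN⟩ := _root_.mem_nhds_iff.mp (inter_mem hleft hD)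
  refine ⟨N, hNopen, hzN, fun w hw => (hNsub hw).2, fun w hw w' hw' hww' => ?_⟩
  have h1 := (hNsub hw).1
  have h2 := (hNsub hw').1
  simp only [mem_setOf_eq] at h1 h2
  rw [← h1, ← h2, hww']

/-- **Uniqueness of sections.** Let `F` be holomorphic on the unit disc and `σ₁`, `σ₂` continuous
on the disc `B = ball c r` with `F (σᵢ w) = w` on `B`, `σ₁` mapping `B` into the unit disc;
suppose that `F` is locally injective along `σ₁` (i.e. `F′ ≠ 0` on `σ₁(B)`). If `σ₁ u₀ = σ₂ u₀` for some
`u₀ ∈ B`, then `σ₁ = σ₂` on `B`. [cite: FisherHubbardWittner1988, §3 p.416] -/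
theorem eqOn_of_holomorphicSections (hF : DifferentiableOn ℂ F (ball 0 1))
    {c : ℂ} {r : ℝ} {σ₁ σ₂ : ℂ → ℂ} (hσ₁ : ContinuousOn σ₁ (ball c r))
    (hσ₂ : ContinuousOn σ₂ (ball c r)) (hσ₁D : MapsTo σ₁ (ball c r) (ball 0 1))
    (hinv₁ : ∀ w ∈ ball c r, F (σ₁ w) = w)
    (hinv₂ : ∀ w ∈ ball c r, F (σ₂ w) = w) (hcrit : ∀ w ∈ ball c r, deriv F (σ₁ w) ≠ 0)
    {u₀ : ℂ} (hu₀ : u₀ ∈ ball c r) (heq : σ₁ u₀ = σ₂ u₀) :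
    EqOn σ₁ σ₂ (ball c r) := by
  -- the coincidence set is open …
  set S : Set ℂ := {u ∈ ball c r | σ₁ u = σ₂ u} with hS
  have hSopen : IsOpen S := by
    rw [isOpen_iff_mem_nhds]
    rintro u ⟨hu, hu'⟩
    obtain ⟨N, hNopen, huN, -, hinj⟩ :=
      exists_isOpen_injOn_of_deriv_ne_zero hF (hσ₁D hu) (hcrit u hu)
    have h1 : ball c r ∩ σ₁ ⁻¹' N ∈ 𝓝 u :=
      (hσ₁.isOpen_inter_preimage isOpen_ball hNopen).mem_nhds ⟨hu, huN⟩
    have h2 : ball c r ∩ σ₂ ⁻¹' N ∈ 𝓝 u :=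
      (hσ₂.isOpen_inter_preimage isOpen_ball hNopen).mem_nhds ⟨hu, by
        show σ₂ u ∈ N; rw [← hu']; exact huN⟩
    filter_upwards [h1, h2] with w hw1 hw2
    refine ⟨hw1.1, hinj hw1.2 hw2.2 ?_⟩
    rw [hinv₁ w hw1.1, hinv₂ w hw1.1]
  -- … closed in the disc, and non-empty; the disc is connected
  have hsub : ball c r ⊆ S := by
    refine (convex_ball c r).isPreconnected.subset_of_closure_inter_subset hSopen
      ⟨u₀, hu₀, hu₀, heq⟩ ?_
    rintro u ⟨huS, hu⟩
    refine ⟨hu, ?_⟩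
    have hne : (𝓝[S] u).NeBot := mem_closure_iff_nhdsWithin_neBot.mp huS
    have hSB : S ⊆ ball c r := fun w hw => hw.1
    have ht1 : Tendsto σ₁ (𝓝[S] u) (𝓝 (σ₁ u)) := (hσ₁ u hu).mono_left (nhdsWithin_mono u hSB)
    have ht2 : Tendsto σ₂ (𝓝[S] u) (𝓝 (σ₂ u)) := (hσ₂ u hu).mono_left (nhdsWithin_mono u hSB)
    have hev : σ₁ =ᶠ[𝓝[S] u] σ₂ := eventually_nhdsWithin_of_forall fun w hw => hw.2
    exact tendsto_nhds_unique_of_eventuallyEq ht1 ht2 hev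
  exact fun u hu => (hsub hu).2

/-- **Brick N1c, criterion half (Fisher–Hubbard–Wittner): local holomorphic sections make a
holomorphic map of the disc a covering.** Let `U ⊆ ℂ` be open and preconnected, `F` holomorphic
on the unit disc `𝔻` with `F(𝔻) ⊆ U`. Assume that for every disc `ball c r ⊆ U` and every `z ∈ 𝔻`
with `F z ∈ ball c r` there is `σ`, holomorphic on `ball c r`, mapping it into `𝔻`, with
`σ (F z) = z` and `F (σ w) = w` on `ball c r`. Then `F` maps `𝔻` onto `U`, and the restriction
`𝔻 → U` of `F` is a covering map. [cite: FisherHubbardWittner1988, §3 p.416] -/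
theorem surjOn_and_isCoveringMap_of_holomorphicSections (hU : IsOpen U) (hUc : IsPreconnected U)
    (hF : DifferentiableOn ℂ F (ball 0 1)) (hFU : MapsTo F (ball 0 1) U)
    (hsec : ∀ (c : ℂ) (r : ℝ), ball c r ⊆ U → ∀ z ∈ ball (0 : ℂ) 1, F z ∈ ball c r →
      ∃ σ : ℂ → ℂ, DifferentiableOn ℂ σ (ball c r) ∧ MapsTo σ (ball c r) (ball 0 1) ∧
        σ (F z) = z ∧ ∀ w ∈ ball c r, F (σ w) = w) :
    SurjOn F (ball 0 1) U ∧ IsCoveringMap hFU.restrict := by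
  classical
  -- choose the sections once and for all
  choose! sec hsec_diff hsec_maps hsec_at hsec_inv using hsec
  have hFc : ContinuousOn F (ball 0 1) := hF.continuousOn
  /- every section forces `F′ ≠ 0` along it -/
  have hcrit : ∀ (c : ℂ) (r : ℝ), ball c r ⊆ U → ∀ z ∈ ball (0 : ℂ) 1, F z ∈ ball c r →
      ∀ w ∈ ball c r, deriv F (sec c r z w) ≠ 0 := by
    intro c r hB z hz hFz w hw
    have hw' : F (sec c r z w) ∈ ball c r := by rw [hsec_inv c r hB z hz hFz w hw]; exact hw
    -- the section through `sec c r z w` at the point `w`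
    refine deriv_ne_zero_of_holomorphicSection hF (hsec_diff c r hB _ (hsec_maps c r hB z hz hFz hw) hw')
      (hsec_maps c r hB _ (hsec_maps c r hB z hz hFz hw) hw')
      (hsec_inv c r hB _ (hsec_maps c r hB z hz hFz hw) hw') hw' ?_
    exact hsec_at c r hB _ (hsec_maps c r hB z hz hFz hw) hw'
  /- uniqueness: a section through `sec c r z w` at `w` IS `sec c r z` -/
  have huniq : ∀ (c : ℂ) (r : ℝ), ball c r ⊆ U → ∀ z ∈ ball (0 : ℂ) 1, F z ∈ ball c r →
      ∀ σ : ℂ → ℂ, ContinuousOn σ (ball c r) →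
      (∀ w ∈ ball c r, F (σ w) = w) → ∀ u₀ ∈ ball c r, σ u₀ = sec c r z u₀ →
      EqOn (sec c r z) σ (ball c r) := by
    intro c r hB z hz hFz σ hσc hσinv u₀ hu₀ hσu₀
    exact eqOn_of_holomorphicSections hF (hsec_diff c r hB z hz hFz).continuousOn hσc
      (hsec_maps c r hB z hz hFz) (hsec_inv c r hB z hz hFz) hσinv (hcrit c r hB z hz hFz)
      hu₀ hσu₀.symm
  refine ⟨?_, ?_⟩
  · /- ### surjectivity: `F(𝔻)` is open and closed in the connected `U` -/
    set V : Set ℂ := F '' ball 0 1 with hV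
    have hVopen : IsOpen V := by
      rw [isOpen_iff_mem_nhds]
      rintro _ ⟨z, hz, rfl⟩
      obtain ⟨r, hr, hBU⟩ := Metric.isOpen_iff.mp hU (F z) (hFU hz)
      have hFz : F z ∈ ball (F z) r := mem_ball_self hr
      refine mem_of_superset (isOpen_ball.mem_nhds hFz) fun w hw => ?_
      exact ⟨sec (F z) r z w, hsec_maps _ _ hBU z hz hFz hw, hsec_inv _ _ hBU z hz hFz w hw⟩
    have hne : (U ∩ V).Nonempty :=
      ⟨F 0, hFU (mem_ball_self one_pos), 0, mem_ball_self one_pos, rfl⟩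
    have key : U ⊆ V := by
      refine hUc.subset_of_closure_inter_subset hVopen hne ?_
      rintro w ⟨hwV, hwU⟩
      obtain ⟨r, hr, hBU⟩ := Metric.isOpen_iff.mp hU w hwU
      obtain ⟨_, ⟨hw'B, z, hz, rfl⟩⟩ :=
        mem_closure_iff_nhds.mp hwV (ball w r) (isOpen_ball.mem_nhds (mem_ball_self hr))
      exact ⟨sec w r z w, hsec_maps _ _ hBU z hz hw'B (mem_ball_self hr),
        hsec_inv _ _ hBU z hz hw'B w (mem_ball_self hr)⟩
    intro w hw
    exact key hw
  · /- ### the covering property: `ball x r ⊆ U` is evenly covered -/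
    intro x
    obtain ⟨r, hr, hBU⟩ := Metric.isOpen_iff.mp hU (x : ℂ) x.2
    -- notation
    set f : ball (0 : ℂ) 1 → U := hFU.restrict with hf
    have hfval : ∀ e : ball (0 : ℂ) 1, ((f e : U) : ℂ) = F e := fun e => rfl
    set I := f ⁻¹' {x} with hI
    have hIx : ∀ i : I, F (i : ball (0 : ℂ) 1) = x := fun i => by
      have h : f (i : ball (0 : ℂ) 1) = x := i.2
      rw [← hfval, h]
    have hxB : ∀ i : I, F (i : ball (0 : ℂ) 1) ∈ ball (x : ℂ) r := fun i => by
      rw [hIx]; exact mem_ball_self hr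
    -- the evenly covered neighbourhood and its preimage
    set V : Set U := Subtype.val ⁻¹' ball (x : ℂ) r with hV
    have hVopen : IsOpen V := isOpen_ball.preimage continuous_subtype_val
    have hxV : x ∈ V := mem_ball_self hr
    have hfV : f ⁻¹' V = Subtype.val ⁻¹' (ball 0 1 ∩ F ⁻¹' ball (x : ℂ) r) := by
      ext e
      simp only [hV, mem_preimage, mem_inter_iff, hfval]
      exact ⟨fun h => ⟨e.2, h⟩, fun h => h.2⟩
    have hfVopen : IsOpen (f ⁻¹' V) := by
      rw [hfV]
      exact (hFc.isOpen_inter_preimage isOpen_ball isOpen_ball).preimage continuous_subtype_val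
    have hmemfV : ∀ e : f ⁻¹' V, F (e : ball (0 : ℂ) 1) ∈ ball (x : ℂ) r := fun e => e.2
    /- local injectivity of `F` near each point of `f ⁻¹' V`, and the resulting local constancy of
    the sheet index `e ↦ (section through e) x` -/
    have hloc : ∀ (z : ℂ) (hz : z ∈ ball (0 : ℂ) 1) (hFz : F z ∈ ball (x : ℂ) r),
        ∀ᶠ z' in 𝓝 z, z' ∈ ball (0 : ℂ) 1 ∧ F z' ∈ ball (x : ℂ) r ∧
          sec x r z' x = sec x r z x := by
      intro z hz hFz
      have hcz : deriv F z ≠ 0 := by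
        have := hcrit (x : ℂ) r hBU z hz hFz (F z) hFz
        rwa [hsec_at _ _ hBU z hz hFz] at this
      obtain ⟨N, hNopen, hzN, hND, hinj⟩ := exists_isOpen_injOn_of_deriv_ne_zero hF hz hcz
      -- `sec x r z ∘ F` is continuous at `z` with value `z ∈ N`
      have hc1 : ContinuousAt (fun z' => sec x r z (F z')) z := by
        have h1 : ContinuousAt F z := hFc.continuousAt (isOpen_ball.mem_nhds hz)
        have h2 : ContinuousAt (sec x r z) (F z) :=
          (hsec_diff _ _ hBU z hz hFz).continuousOn.continuousAt (isOpen_ball.mem_nhds hFz)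
        exact h2.comp h1
      have hev1 : ∀ᶠ z' in 𝓝 z, sec x r z (F z') ∈ N := by
        refine hc1.preimage_mem_nhds (hNopen.mem_nhds ?_)
        rw [hsec_at _ _ hBU z hz hFz]; exact hzN
      have hev2 : ∀ᶠ z' in 𝓝 z, z' ∈ N := hNopen.mem_nhds hzN
      have hev3 : ∀ᶠ z' in 𝓝 z, F z' ∈ ball (x : ℂ) r :=
        (hFc.continuousAt (isOpen_ball.mem_nhds hz)).preimage_mem_nhds (isOpen_ball.mem_nhds hFz)
      filter_upwards [hev1, hev2, hev3] with z' h1 h2 h3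
      have hz'D : z' ∈ ball (0 : ℂ) 1 := hND h2
      refine ⟨hz'D, h3, ?_⟩
      -- `sec x r z` passes through `z'` (local injectivity), hence equals `sec x r z'`
      have hthrough : sec x r z (F z') = z' := by
        refine hinj h1 h2 ?_
        exact hsec_inv _ _ hBU z hz hFz (F z') h3
      have hEq : EqOn (sec x r z') (sec x r z) (ball (x : ℂ) r) :=
        huniq _ _ hBU z' hz'D h3 (sec x r z) (hsec_diff _ _ hBU z hz hFz).continuousOn
          (hsec_inv _ _ hBU z hz hFz) (F z') h3
          (by rw [hthrough, hsec_at _ _ hBU z' hz'D h3])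
      exact hEq (mem_ball_self hr)
    -- the sheet index of a point of `f ⁻¹' V`
    have hidxD : ∀ e : f ⁻¹' V, sec x r (e : ball (0 : ℂ) 1) x ∈ ball (0 : ℂ) 1 := fun e =>
      hsec_maps _ _ hBU _ (e : ball (0 : ℂ) 1).2 (hmemfV e) (mem_ball_self hr)
    have hidxI : ∀ e : f ⁻¹' V, (⟨sec x r (e : ball (0 : ℂ) 1) x, hidxD e⟩ : ball (0 : ℂ) 1) ∈ I :=
      fun e => by
      rw [hI, mem_preimage, mem_singleton_iff]
      apply Subtype.ext
      rw [hfval]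
      exact hsec_inv _ _ hBU _ (e : ball (0 : ℂ) 1).2 (hmemfV e) _ (mem_ball_self hr)
    set idx : f ⁻¹' V → I := fun e => ⟨⟨sec x r (e : ball (0 : ℂ) 1) x, hidxD e⟩, hidxI e⟩
      with hidx
    have hidx_val : ∀ e : f ⁻¹' V, ((idx e : ball (0 : ℂ) 1) : ℂ) = sec x r (e : ball (0 : ℂ) 1) x :=
      fun e => rfl
    have hidx_cont : Continuous idx := by
      refine continuous_iff_continuousAt.mpr fun e => ?_
      -- `idx` is constant near `e`
      have hev := hloc (e : ball (0 : ℂ) 1) (e : ball (0 : ℂ) 1).2 (hmemfV e)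
      have hev' : ∀ᶠ e' in 𝓝 e, idx e' = idx e := by
        have hc : Continuous fun e' : f ⁻¹' V => ((e' : ball (0 : ℂ) 1) : ℂ) :=
          continuous_subtype_val.comp continuous_subtype_val
        filter_upwards [hc.continuousAt.eventually hev] with e' he'
        apply Subtype.ext; apply Subtype.ext
        rw [hidx_val, hidx_val]
        exact he'.2.2
      exact (continuousAt_const : ContinuousAt (fun _ : f ⁻¹' V => idx e) e).congr
        (hev'.mono fun _ h => h.symm)
    -- the sheet through a fibre point, evaluated at a point of `V`
    have hshD : ∀ (y : V) (i : I), sec x r (i : ball (0 : ℂ) 1) y ∈ ball (0 : ℂ) 1 := fun y i =>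
      hsec_maps _ _ hBU _ (i : ball (0 : ℂ) 1).2 (hxB i) y.2
    have hshV : ∀ (y : V) (i : I), (⟨sec x r (i : ball (0 : ℂ) 1) y, hshD y i⟩ : ball (0 : ℂ) 1) ∈
        f ⁻¹' V := fun y i => by
      change F (sec x r (i : ball (0 : ℂ) 1) y) ∈ ball (x : ℂ) r
      rw [hsec_inv _ _ hBU _ (i : ball (0 : ℂ) 1).2 (hxB i) _ y.2]
      exact y.2
    set sh : V × I → f ⁻¹' V := fun p => ⟨⟨sec x r (p.2 : ball (0 : ℂ) 1) p.1, hshD p.1 p.2⟩,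
      hshV p.1 p.2⟩ with hsh
    have hsh_val : ∀ p : V × I, (((sh p : f ⁻¹' V) : ball (0 : ℂ) 1) : ℂ) =
        sec x r (p.2 : ball (0 : ℂ) 1) p.1 := fun p => rfl
    /- the fibre is discrete -/
    have hIdisc : DiscreteTopology I := by
      rw [hI, discreteTopology_subtype_iff']
      intro i hi
      have hi' : F (i : ℂ) = x := by
        rw [mem_preimage, mem_singleton_iff] at hi
        rw [← hfval, hi]
      have hFi : F (i : ℂ) ∈ ball (x : ℂ) r := by rw [hi']; exact mem_ball_self hr
      have hci : deriv F i ≠ 0 := by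
        have := hcrit (x : ℂ) r hBU i i.2 hFi (F i) hFi
        rwa [hsec_at _ _ hBU i i.2 hFi] at this
      obtain ⟨N, hNopen, hiN, -, hinj⟩ := exists_isOpen_injOn_of_deriv_ne_zero hF i.2 hci
      refine ⟨Subtype.val ⁻¹' N, hNopen.preimage continuous_subtype_val, ?_⟩
      ext e
      simp only [mem_inter_iff, mem_preimage, mem_singleton_iff]
      constructor
      · rintro ⟨heN, he⟩
        apply Subtype.ext
        refine hinj heN hiN ?_
        rw [hi', ← hfval, he]
      · rintro rfl
        exact ⟨hiN, hi⟩
    /- the trivialisation `f ⁻¹' V ≃ₜ V × I` -/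
    have hleft : ∀ e : f ⁻¹' V, sh (⟨f (e : ball (0 : ℂ) 1), e.2⟩, idx e) = e := by
      intro e
      apply Subtype.ext; apply Subtype.ext
      rw [hsh_val]
      change sec x r (sec x r (e : ball (0 : ℂ) 1) x) (F e) = (e : ℂ)
      have heD := (e : ball (0 : ℂ) 1).2
      have heB := hmemfV e
      -- both `sec x r (idx e)` and `sec x r e` are sections through `idx e` at `x`
      have hEq : EqOn (sec x r (sec x r (e : ball (0 : ℂ) 1) x)) (sec x r (e : ball (0 : ℂ) 1))
          (ball (x : ℂ) r) := by
        have hζD : sec x r (e : ball (0 : ℂ) 1) x ∈ ball (0 : ℂ) 1 := hidxD e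
        have hζB : F (sec x r (e : ball (0 : ℂ) 1) x) ∈ ball (x : ℂ) r := by
          rw [hsec_inv _ _ hBU _ heD heB _ (mem_ball_self hr)]; exact mem_ball_self hr
        refine huniq _ _ hBU _ hζD hζB (sec x r (e : ball (0 : ℂ) 1))
          (hsec_diff _ _ hBU _ heD heB).continuousOn
          (hsec_inv _ _ hBU _ heD heB) x (mem_ball_self hr) ?_
        -- value of `sec x r ζ` at `F ζ = x` is `ζ`
        have h1 := hsec_at _ _ hBU _ hζD hζB
        rw [hsec_inv _ _ hBU _ heD heB _ (mem_ball_self hr)] at h1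
        rw [h1]
      rw [hEq heB]
      exact hsec_at _ _ hBU _ heD heB
    have hright : ∀ p : V × I, (⟨f ((sh p : f ⁻¹' V) : ball (0 : ℂ) 1), (sh p).2⟩, idx (sh p)) = p := by
      rintro ⟨y, i⟩
      have hiD := (i : ball (0 : ℂ) 1).2
      have hy1 : F (sec x r (i : ball (0 : ℂ) 1) y) = y := hsec_inv _ _ hBU _ hiD (hxB i) _ y.2
      refine Prod.ext ?_ ?_
      · apply Subtype.ext; apply Subtype.ext
        change F (sec x r (i : ball (0 : ℂ) 1) y) = (y : ℂ)
        exact hy1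
      · apply Subtype.ext; apply Subtype.ext
        rw [hidx_val]
        change sec x r (sec x r (i : ball (0 : ℂ) 1) y) x = ((i : ball (0 : ℂ) 1) : ℂ)
        -- `sec x r i` is a section through `sec x r i y` at `y`; so is `sec x r (sec x r i y)`
        have hζD : sec x r (i : ball (0 : ℂ) 1) y ∈ ball (0 : ℂ) 1 := hshD y i
        have hζB : F (sec x r (i : ball (0 : ℂ) 1) y) ∈ ball (x : ℂ) r := by rw [hy1]; exact y.2
        have hEq : EqOn (sec x r (sec x r (i : ball (0 : ℂ) 1) y)) (sec x r (i : ball (0 : ℂ) 1))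
            (ball (x : ℂ) r) :=
          huniq _ _ hBU _ hζD hζB (sec x r (i : ball (0 : ℂ) 1))
            (hsec_diff _ _ hBU _ hiD (hxB i)).continuousOn
            (hsec_inv _ _ hBU _ hiD (hxB i)) (F (sec x r (i : ball (0 : ℂ) 1) y)) hζB
            (by rw [hsec_at _ _ hBU _ hζD hζB, hy1])
        rw [hEq (mem_ball_self hr)]
        have h1 := hsec_at _ _ hBU _ hiD (hxB i)
        rwa [hIx i] at h1
    have hsh_cont : Continuous sh := by
      haveI := hIdisc
      refine continuous_iff_continuousAt.mpr fun p => ?_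
      obtain ⟨y, i⟩ := p
      -- on the open set `V × {i}` the map is `y ↦ sec x r i y`
      have hslice : Continuous fun y' : V => sh (y', i) := by
        apply Continuous.subtype_mk
        apply Continuous.subtype_mk
        exact ((hsec_diff _ _ hBU _ (i : ball (0 : ℂ) 1).2 (hxB i)).continuousOn.comp_continuous
          (continuous_subtype_val.comp continuous_subtype_val) fun y' => y'.2)
      have hev : (fun p : V × I => sh (p.1, i)) =ᶠ[𝓝 (y, i)] sh := by
        have hmem : (univ : Set V) ×ˢ ({i} : Set I) ∈ 𝓝 (y, i) :=
          prod_mem_nhds univ_mem ((isOpen_discrete _).mem_nhds rfl)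
        filter_upwards [hmem] with p hp
        obtain ⟨-, hp2⟩ := hp
        rw [mem_singleton_iff] at hp2
        rw [← hp2]
      exact ((hslice.comp continuous_fst).continuousAt).congr hev
    let H : f ⁻¹' V ≃ₜ V × I :=
      { toFun := fun e => (⟨f (e : ball (0 : ℂ) 1), e.2⟩, idx e)
        invFun := sh
        left_inv := hleft
        right_inv := hright
        continuous_toFun := by
          refine Continuous.prodMk ?_ hidx_cont
          exact ((hFc.mapsToRestrict hFU).comp continuous_subtype_val).subtype_mk _
        continuous_invFun := hsh_cont }
    exact ⟨hIdisc, V, hxV, hVopen, hfVopen, H, fun e => rfl⟩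

end Complex

end
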